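import Summits.HodgeConjecture.HodgeConjecture.Theses.NikulinTwinTransport
import Summits.HodgeConjecture.HodgeConjecture.Theorems.TwinTwistorTransport.Negative.AnchorConeCondition
import Summits.HodgeConjecture.HodgeConjecture.Theorems.TwinTwistorTransport.Negative.GenericFirstLine
import Summits.HodgeConjecture.HodgeConjecture.Theorems.TwinTwistorTransport.Negative.NikulinParity
import Summits.HodgeConjecture.HodgeConjecture.Theorems.TwinTwistorTransport.Negative.PolystableCrossTerm

/-!
# Disproof of `TwinTwistorTransport` (stmt-HodgeConjecture-14393, TYPED rev-7 output form) — findings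

Standing disprover `refuter-cdisprove-stmt-HodgeConjecture-14393-0` (gen 1 on the typed item; the
gen-1/gen-2 seats on the informal predecessor stmt-14522 never crux-published their work file, so
this file is the FIRST `Cruxes/TwinTwistorTransport/Disproof.lean`; their conclusive content is the
four LANDED modules imported above and indexed in §0).

The crux (route NikulinTwinTransport r4, `Theses.NikulinTwinTransport.TwinTwistorTransport`):
for every orientation family `μ` with Poincaré duality, every projective K3 surface `S`
(`IsK3Surface` unfolded) and every integral generator `p` of `H⁴(S(ℂ);ℂ)`, there are a projective
K3 surface `S″`, a generator `p″`, and a `ℂ`-linear equivalence `Ψ : H²(S″) ≃ H²(S)` with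
(R) `Ψ⁻¹` rational, (T) `Ψ⁻¹` type-preserving, (H) `u.v = 2b·p ⟹ Ψ⁻¹u.Ψ⁻¹v = b·p″`,
(A) `Ψ = [γ]_* = fst_*(snd^*(–) ∪ γ)`, `γ ∈ algebraicClasses (S ⊗ S″) 2`.

## Verdict (cycle 1): NO KILL — and why it resists

* In print the crux is IMPLIED BY the Hodge conjecture for the fourfolds `S × S″`: TwinExists
  (route item 13677: markings + the integral 2-similitude `M` of `Λ_K3` + surjectivity of the period
  map) gives a projective twin `S″` and a rational Hodge 2-similitude `ψ : H²(S″,ℚ) → H²(S,ℚ)`; `ψ` is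
  a Hodge class on `S × S″`, algebraic under HC; `Ψ := ψ` then satisfies (R)(T)(H)(A).  So every
  counterexample to the crux is a non-algebraic Hodge class on a product of two projective K3
  surfaces, i.e. refutes `_root_.HodgeConjecture` (kill criterion (iii) of the route).  No such
  class is known or expected; no unconditional `¬` is available, and no honest `H → ¬crux` with a
  constructible-in-principle `H` exists either (`H` would itself be a counterexample to HC).
* KNOWN CASES (in print, unconditional): the crux holds for every `S` on the NIKULIN LOCUS (`S = X`
  with a Nikulin involution: `S″ := Y′` the resolved quotient, `Ψ :=` the completed similitude
  `g^* ⊕ (Nⱼ ↦ rⱼ)`, algebraic as `[Γ] +` products of divisors; Varesco 2023 §2, van Geemen–Sarti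
  2007) and on the EVEN-EIGHT LOCUS (`S = Y′`: `S″ := X`, `Ψ := 2·(completed g^*)⁻¹ =` the adjoint,
  a transpose of an algebraic correspondence); both need `ρ(S) ≥ 9`.  OPEN for `ρ(S) ≤ 8`, in
  particular for the very general member of every family of projective K3 surfaces, where it is
  EQUIVALENT to algebraicity of the single Hodge class `ψ` on `S × S″` (Hom_Hdg(T″,T) = ℚψ).
* The typed form is ROBUST against junk: §T1–T9 below record, as shadow theorems over fields /
  lattices (the real carriers `complexBetti`, `IsRationalClass`, K3 surfaces are not constructible in
  the tree, so every `_false_without_` statement is proved on its linear-algebra shadow):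
  - T1 `selfAnchor_smul_passes_all_but_rationality`: WITHOUT (R) the crux is closed by the junk
    self-anchor `S″ = S`, `p″ = p`, `Ψ = √2·id` — (H) holds identically, (T) holds for every
    subspace, and (A) holds modulo `[Δ]_* = id` because `algebraicClasses` is a `ℂ`-subspace
    (`√2·[Δ]` is "algebraic" in the tree's `ℂ`-span sense).  So (R) CARRIES THE WHOLE CONTENT; any
    proof must use that `IsRationalClass` is a genuine `ℚ`-structure (not closed under `ℂˣ`).
  - T1′ `withoutR_of_diagonalClass` (REAL CARRIERS): the crux with (R) deleted
    (`TwinTwistorTransportWithoutR`, verbatim otherwise) FOLLOWS from `DiagonalClass` (an algebraic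
    `Δ ∈ algebraicClasses (S ⊗ S) 2` with `fst_*(snd^*x ∪ Δ) = x`, Fulton Prop. 16.1.1) — proved on
    `complexBetti` / `cupProduct` / `complexGysin` / `IsOfHodgeType` themselves, rc 0.
  - T2′ `withoutH_of_diagonalClass` (REAL CARRIERS): the crux with (H) deleted follows from
    `DiagonalClass` too (witness `Ψ = id`).  With T1′: modulo `[Δ]_* = id` the crux's content is
    exactly (R) ∧ (H) jointly — a rational algebraic correspondence that is also a 2-similitude.
  - T2 `halving_id_forces_zero`: the DIAGONAL is not an instance — `Ψ = id` (`S″ = S`, Buskin's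
    identity / a Fourier–Mukai partner, the route's "cheapest falsifier") satisfies (H) only if the
    cup form vanishes.  The multiplier is rigid: the typed crux cannot be tested at `Ψ = id`; that
    test concerns the MECHANISM (carrier + transport), not this output statement.
  - T3 `det_sq_mul_det_of_twoSimilitude`, `no_self_twoSimilitude_of_odd`,
    `no_isometric_twin_of_odd`: a multiplier-2
    self-similitude of a nondegenerate quadratic `ℚ`-space of ODD dimension does not exist
    (`det Ψ² = 2ⁿ`).  Hence the strengthening `S″ = S` is FALSE whenever `rk T(S) = 22 − ρ(S)` is odd
    (a Hodge similitude preserves `T`), e.g. `ρ = 1`: the `∃ S″` is load-bearing, and for odd rank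
    `disc T(S″) ≡ 2·disc T(S) mod squares`, so the twin is NEVER Hodge-isometric to `S` (no FM
    partner, Buskin alone never supplies the anchor: a genuinely non-isometric algebraic class is
    required).
  - T4 `not_integral_halving`: the strengthening "`Ψ⁻¹` integral" is FALSE (`Λ_K3` is unimodular:
    `e.f = 1` in `U`, and `1 ≠ 2k`); `Ψ⁻¹` is at best half-integral, while `Ψ` itself CAN be
    integral (landed `Theorems.eEightTwoSimilitude_proof`: `U(2) ⊂ U`, `E₈(2) ⊂ E₈`).  The typed
    clause rightly asks only rationality.
  - T5 `symm_mem_of_map_le_of_finrank_eq`, T6 `symm_mem_of_forall_mem`: (T) and (R) for `Ψ⁻¹`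
    FOLLOW from the same properties of `Ψ` plus equality of dimensions (`h^{i,j}(S″) = h^{i,j}(S)`,
    `b₂ = 22` on the `ℚ`-forms) — an algebraic `Ψ` is rational and type-preserving in print, so
    (R)(T) are bookkeeping a prover discharges from (A) + bijectivity; they are not extra content.
  - T7 `halving_iff_twoSimilitude`: (H) is exactly "`Ψ` is a 2-similitude" (given bijectivity and
    `2 ≠ 0`), the hypothesis shape consumed by `Theorems.twinSimilitudeAlgebraic_of_anchor`.
  - T8 `orientation_rescaling_absorbed`: the outer `∀ μ` is harmless — a change of `ℂ`-orientation
    family rescales `fst_*` by a unit, absorbed by `γ ↦ c⁻¹γ` inside the `ℂ`-subspace of algebraic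
    classes.
  - T9 `sign_of_generator_absorbed`: the sign ambiguity `p ↦ −p` of the `∀ p` is absorbed by the
    `∃ p″` (`p″ ↦ −p″`).
* NOT attackable here (recorded for the next cycle): exotic Hodge models.  `IsOfHodgeType` is
  `∃ A : HodgeModel`, and the type clause runs `S → S″`; if a non-standard natural de Rham family
  ENLARGED `H^{2,0}(S)` without a matching enlargement on `S″`, (T) could fail for the wrong reason.
  The Literature docstring (RationalHodgeClasses, "junk analysis") argues all models agree (natural
  automorphisms of `Hᵏ(−;ℂ)` on manifolds charted on `E` are scalars, Thom); not checkable in Lean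
  today; no action.

## Proof obligations the attack surfaces (for provers / planners; not defects of the statement)
* (T) is quantified over `IsOfHodgeType 2 S (2*1) i j` = `∃ A : HodgeModel 2 S, …` — a proof must
  handle classes typed by ANY Hodge model `A` of `S` and produce a model of `S″` typing `Ψ⁻¹y`.
  This needs the model-independence lemma promised in the docstring of
  `Literature/AlgebraicGeometry/HodgeTheory/RationalHodgeClasses` ("all Hodge models give the same
  `(p,q)` classes"; NOT in the tree), or a transport-of-model construction; and comparing types under
  the correspondence `[γ]_*` needs a de Rham comparison on `(S × S″)^an`, charted on `E × E`, which
  lies OUTSIDE the naturality family `A.deRham` of a single model (charted on `E`).  By T5 it is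
  enough to prove (T) for `Ψ` itself plus `h^{i,j}(S) = h^{i,j}(S″)`; for `i + j ≠ 2` the clause is
  junk-harmless (both sides have models; `hodgePQ 2 i j` is model-uniformly `⊥` or everything).
* (R) for `Ψ⁻¹` from (R) for `Ψ` (T6) needs `finrank_ℚ {rational classes} = 22` on both sides, i.e.
  universal coefficients `H²(X(ℂ);ℚ) ⊗ ℂ ≅ H²(X(ℂ);ℂ)` for the tree's `IsRationalClass` — also the
  fact that makes T1′ harmless ((R) genuinely excludes `√2 • id` only if rational classes form a
  `ℚ`-form; the library does not yet prove `IsRationalClass (c • y) → IsRationalClass y → y ≠ 0 →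
  c ∈ ℚ`, cf. rattack-14393 Triv2.lean).
* (H) is stated against `p`, `p″`; exhibiting `p″` needs `H⁴(S″(ℂ);ℤ)`-generators, i.e. the
  orientation class is integral and generates (Poincaré duality over `ℤ` for the tree's carriers).
* `S″` must be EXHIBITED as a `SchemeOver ℂ` with the K3 block: only via
  `Huybrechts_K3_periodSurjective_projective` (named, unproved, deliberately not imported by the
  route file) — the twin is never `S` itself for odd `rk T(S)` (T3), so no shortcut exists.

## Literature (degraded search 2026-08-16: local FTS down, OpenAlex/S2 429; crossref/arXiv/zbMATH up)
Nearest prior art unchanged: Varesco 2023 (doi:10.1007/s00209-023-03390-8) §2 — multiplier-`p`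
similarities algebraic ON the `σ_p`/Nikulin locus only.  Noted for planners (sector context, not this
crux): Schlickewei 2010 (doi:10.1016/j.jalgebra.2010.04.010, arXiv:0907.2503, held) Thm 2 — HC for
`S × S`, `S` a double cover of `ℙ²` branched in six lines, incl. 1-dim subfamilies with real
multiplication by a real quadratic field (p. 2: "examples of K3 surfaces with non-trivial real
multiplication for which End_Hdg(T(S)) is generated by algebraic classes"); Ramón Marí 2008
(doi:10.1007/bf03191179); Varesco 2025 (doi:10.1307/mmj/20236349, powers of K3 with `ρ = 16`).
No printed counterexample candidate to a multiplier-2 similitude being algebraic exists.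

## LANDED from this cycle (importable: `Summits.HodgeConjecture.HodgeConjecture.Theorems.TwinTwistorTransport.Negative.*`)
* `Negative/NoOddSelfAnchor.lean` (p80577 @074fd9a481a7): `det_sq_mul_det_of_twoSimilitude`,
  `det_sq_mul_det_of_isometry`, `no_self_twoSimilitude_of_odd`, `no_isometric_twin_of_odd`,
  `self_twoSimilitude_even_example` (= T3 below).
* `Negative/TypedClauseHygiene.lean` (p80656 @20a055b94c44): T1, T2, T4–T9 below, same names.
* `Negative/WithoutRationalityOrHalving.lean` (p80769 @50c2de0ce228): `withoutR_of_diagonalClass`,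
  `withoutH_of_diagonalClass` with the hypothesis / conclusions INLINED (no defs) (= T1′/T2′ below).
This work file keeps its own copies (namespace `…Cruxes.TwinTwistorTransport.Disproof`) so that it
elaborates standalone; cite the `Negative.*` names in skeletons.

## §0 Index of the predecessor findings (informal 14522 form; LANDED, imported above)
* F2 generic-line rigidity — `Negative.eq_zero_of_oneOne_along_generic_line` (GenericFirstLine);
* F3 Nikulin parity — `Negative.evenEight_ne_nodal_add_two_smul` (NikulinParity);
* F4 rational first ray never generic — `Negative.exists_integral_perp_of_rational_ray`;
* F7 polystable cross term — `Negative.finrank_le_of_restrict_eq_smul` (PolystableCrossTerm);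
* F9 anchor cone condition — `Negative.no_minusTwo_class_of_even_degree`,
  `Negative.minusTwo_class_of_degree_one` (AnchorConeCondition).
They concern the hyperkähler ROAD (mechanism clauses (a)–(c)), which the typed output form no
longer states; they remain the negatives any Line skeleton must honour.

## Targets
`payload.targets = []`, `stuck_stubs = []` at this cycle — no stub kills to attempt.
-/

namespace Summit.HodgeConjecture.HodgeConjecture.Cruxes.TwinTwistorTransport.Disproof

open scoped BigOperators Matrix

/-! ## T1 — without (R) the crux is junk-true: the self-anchor `Ψ = √2 • id` -/

/-- T1 (LOAD-BEARING (R)).  Over any field with `c² = 2 ≠ 0`, the self-map `Ψ = c • id` passes every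
clause of the crux except rationality: (H) `B u v = 2b ⟹ B (c⁻¹u) (c⁻¹v) = b`; (T) `c⁻¹ •` preserves
every subspace; (A) `c • id ∈ K ∙ id` (and `id = [Δ]_*`, `algebraicClasses` a `ℂ`-subspace).  So the
crux WITHOUT the clause `IsRationalClass (Ψ.symm y)` is closed by `S″ = S`, and any proof of the crux
must use that rational classes are not closed under `√2`. [folklore] -/
theorem selfAnchor_smul_passes_all_but_rationality {K V : Type*} [Field K] [AddCommGroup V] [Module K V]
    (B : V →ₗ[K] V →ₗ[K] K) {c : K}
    (hc : c * c = 2) (h2 : (2 : K) ≠ 0) :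
    (∀ (u v : V) (b : K), B u v = 2 * b → B (c⁻¹ • u) (c⁻¹ • v) = b) ∧
    (∀ (W : Submodule K V), ∀ y ∈ W, c⁻¹ • y ∈ W) ∧
    (c • (LinearMap.id : V →ₗ[K] V) ∈ Submodule.span K {(LinearMap.id : V →ₗ[K] V)}) := by
  have hc0 : c ≠ 0 := by
    rintro rfl
    exact h2 (by simpa using hc.symm)
  refine ⟨fun u v b h => ?_, fun W y hy => W.smul_mem _ hy,
    Submodule.smul_mem _ _ (Submodule.subset_span rfl)⟩
  rw [LinearMap.map_smul₂, map_smul, smul_eq_mul, smul_eq_mul, h]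
  have : c⁻¹ * (c⁻¹ * (2 * b)) = (c * c)⁻¹ * 2 * b := by
    rw [mul_inv]
    ring
  rw [this, hc, inv_mul_cancel₀ h2, one_mul]


/-! ## T1′/T2′ — on the REAL carriers: without (R), or without (H), the crux reduces to the diagonal class -/

section RealCarriers

open Literature.AlgebraicGeometry.HodgeTheory Literature.AlgebraicTopology.SingularHomology
open CategoryTheory
open scoped Manifold ContDiff

/-- The crux `TwinTwistorTransport` with the rationality clause (R) `∀ y, IsRationalClass y →
IsRationalClass (Ψ.symm y)` DELETED, everything else verbatim (the real carriers). -/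
def TwinTwistorTransportWithoutR : Prop :=
  ∀ (μ : Literature.AlgebraicGeometry.HodgeTheory.OrientationFamily), μ.HasPoincareDuality → ∀ (S : Literature.AlgebraicGeometry.Motives.SchemeOver ℂ) (hS : (Literature.AlgebraicGeometry.Motives.IsSmoothProjective 2 S ∧ Subsingleton (Literature.AlgebraicGeometry.Motives.structureSheafCohomology S.left 1) ∧ ∃ (A : Literature.AlgebraicGeometry.HodgeTheory.HodgeModel 2 S) (η : Literature.Geometry.Kaehler.MForm 𝓘(ℝ, A.model) A.carrier ℂ 2), Literature.Geometry.Kaehler.IsHolomorphicInCharts η ∧ ∀ x, η x ≠ 0)) (p : Literature.AlgebraicGeometry.HodgeTheory.complexBetti S (2 * 2)), (Literature.AlgebraicGeometry.HodgeTheory.IsIntegralClass p ∧ ∀ q : Literature.AlgebraicGeometry.HodgeTheory.complexBetti S (2 * 2), Literature.AlgebraicGeometry.HodgeTheory.IsIntegralClass q → ∃ n : ℤ, q = n • p) → ∃ (S'' : Literature.AlgebraicGeometry.Motives.SchemeOver ℂ) (hS'' : (Literature.AlgebraicGeometry.Motives.IsSmoothProjective 2 S'' ∧ Subsingleton (Literature.AlgebraicGeometry.Motives.structureSheafCohomology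 S''.left 1) ∧ ∃ (A : Literature.AlgebraicGeometry.HodgeTheory.HodgeModel 2 S'') (η : Literature.Geometry.Kaehler.MForm 𝓘(ℝ, A.model) A.carrier ℂ 2), Literature.Geometry.Kaehler.IsHolomorphicInCharts η ∧ ∀ x, η x ≠ 0)) (p'' : Literature.AlgebraicGeometry.HodgeTheory.complexBetti S'' (2 * 2)), (Literature.AlgebraicGeometry.HodgeTheory.IsIntegralClass p'' ∧ ∀ q : Literature.AlgebraicGeometry.HodgeTheory.complexBetti S'' (2 * 2), Literature.AlgebraicGeometry.HodgeTheory.IsIntegralClass q → ∃ n : ℤ, q = n • p'') ∧ ∃ Ψ : Literature.AlgebraicGeometry.HodgeTheory.complexBetti S'' (2 * 1) ≃ₗ[ℂ] Literature.AlgebraicGeometry.HodgeTheory.complexBetti S (2 * 1), (∀ (i j : ℕ) y, Literature.AlgebraicGeometry.HodgeTheory.IsOfHodgeType 2 S (2 * 1) i j y → Literature.AlgebraicGeometry.HodgeTheory.IsOfHodgeType 2 S'' (2 * 1) i j (Ψ.symm y)) ∧ (∀ (u v : Literature.AlgebraicGeometry.HodgeTheory.complexBetti S (2 * 1)) (b :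 ℂ), Literature.AlgebraicTopology.SingularHomology.cupProduct (rfl : 2 * 1 + 2 * 1 = 2 * 2) u v = ((2 : ℂ) * b) • p → Literature.AlgebraicTopology.SingularHomology.cupProduct (rfl : 2 * 1 + 2 * 1 = 2 * 2) (Ψ.symm u) (Ψ.symm v) = b • p'') ∧ ∃ γ ∈ Literature.AlgebraicGeometry.HodgeTheory.algebraicClasses (CategoryTheory.MonoidalCategoryStruct.tensorObj S S'') 2, ∀ x : Literature.AlgebraicGeometry.HodgeTheory.complexBetti S'' (2 * 1), Ψ x = Literature.AlgebraicGeometry.HodgeTheory.complexGysin μ (Literature.AlgebraicGeometry.Motives.IsSmoothProjective.tensor_holds hS.1 hS''.1) hS.1 (CategoryTheory.SemiCartesianMonoidalCategory.fst S S'') (rfl : 2 * 1 + 2 * 2 + 2 * 2 = 2 * 1 + 2 * (2 + 2)) (Literature.AlgebraicTopology.SingularHomology.cupProduct (rfl : 2 * 1 + 2 * 2 = 2 * 1 + 2 * 2) (Literature.AlgebraicGeometry.HodgeTheory.complexBetti.map (CategoryTheory.SemiCartesianMonoidalCategory.snd S S'') (2 * 1) x) γ)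

/-- The diagonal correspondence acts as the identity: for every smooth projective K3-block `S` there is
an algebraic codimension-2 class `Δ` on `S ⊗ S` with `fst_*(snd^* x ∪ Δ) = x` (Fulton 1998,
Ex. 16.1.2 / Prop. 16.1.1; the graph of the identity). A standard fact about the real carriers, not yet
in the tree. -/
def DiagonalClass : Prop :=
  ∀ (μ : Literature.AlgebraicGeometry.HodgeTheory.OrientationFamily), μ.HasPoincareDuality → ∀ (S : Literature.AlgebraicGeometry.Motives.SchemeOver ℂ) (hS : (Literature.AlgebraicGeometry.Motives.IsSmoothProjective 2 S ∧ Subsingleton (Literature.AlgebraicGeometry.Motives.structureSheafCohomology S.left 1) ∧ ∃ (A : Literature.AlgebraicGeometry.HodgeTheory.HodgeModel 2 S) (η : Literature.Geometry.Kaehler.MForm 𝓘(ℝ, A.model) A.carrier ℂ 2), Literature.Geometry.Kaehler.IsHolomorphicInCharts η ∧ ∀ x, η x ≠ 0)), ∃ Δ ∈ Literature.AlgebraicGeometry.HodgeTheory.algebraicClasses (CategoryTheory.MonoidalCategoryStruct.tensorObj S S) 2, ∀ x : Literature.AlgebraicGeometry.HodgeTheory.complexBetti S (2 * 1), Literature.AlgebraicGeometry.HodgeTheory.complexGysin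 μ (Literature.AlgebraicGeometry.Motives.IsSmoothProjective.tensor_holds hS.1 hS.1) hS.1 (CategoryTheory.SemiCartesianMonoidalCategory.fst S S) (rfl : 2 * 1 + 2 * 2 + 2 * 2 = 2 * 1 + 2 * (2 + 2)) (Literature.AlgebraicTopology.SingularHomology.cupProduct (rfl : 2 * 1 + 2 * 2 = 2 * 1 + 2 * 2) (Literature.AlgebraicGeometry.HodgeTheory.complexBetti.map (CategoryTheory.SemiCartesianMonoidalCategory.snd S S) (2 * 1) x) Δ) = x

/-- The crux `TwinTwistorTransport` with the halving clause (H) `u.v = 2b·p → Ψ⁻¹u.Ψ⁻¹v = b·p″`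
DELETED, everything else verbatim (the real carriers; `p″` is still produced). -/
def TwinTwistorTransportWithoutH : Prop :=
  ∀ (μ : Literature.AlgebraicGeometry.HodgeTheory.OrientationFamily), μ.HasPoincareDuality → ∀ (S : Literature.AlgebraicGeometry.Motives.SchemeOver ℂ) (hS : (Literature.AlgebraicGeometry.Motives.IsSmoothProjective 2 S ∧ Subsingleton (Literature.AlgebraicGeometry.Motives.structureSheafCohomology S.left 1) ∧ ∃ (A : Literature.AlgebraicGeometry.HodgeTheory.HodgeModel 2 S) (η : Literature.Geometry.Kaehler.MForm 𝓘(ℝ, A.model) A.carrier ℂ 2), Literature.Geometry.Kaehler.IsHolomorphicInCharts η ∧ ∀ x, η x ≠ 0)) (p : Literature.AlgebraicGeometry.HodgeTheory.complexBetti S (2 * 2)), (Literature.AlgebraicGeometry.HodgeTheory.IsIntegralClass p ∧ ∀ q : Literature.AlgebraicGeometry.HodgeTheory.complexBetti S (2 * 2), Literature.AlgebraicGeometry.HodgeTheory.IsIntegralClass q → ∃ n : ℤ, q = n • p) → ∃ (S'' : Literature.AlgebraicGeometry.Motives.SchemeOver ℂ) (hS'' : (Literature.AlgebraicGeometry.Motives.IsSmoothProjective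 2 S'' ∧ Subsingleton (Literature.AlgebraicGeometry.Motives.structureSheafCohomology S''.left 1) ∧ ∃ (A : Literature.AlgebraicGeometry.HodgeTheory.HodgeModel 2 S'') (η : Literature.Geometry.Kaehler.MForm 𝓘(ℝ, A.model) A.carrier ℂ 2), Literature.Geometry.Kaehler.IsHolomorphicInCharts η ∧ ∀ x, η x ≠ 0)) (p'' : Literature.AlgebraicGeometry.HodgeTheory.complexBetti S'' (2 * 2)), (Literature.AlgebraicGeometry.HodgeTheory.IsIntegralClass p'' ∧ ∀ q : Literature.AlgebraicGeometry.HodgeTheory.complexBetti S'' (2 * 2), Literature.AlgebraicGeometry.HodgeTheory.IsIntegralClass q → ∃ n : ℤ, q = n • p'') ∧ ∃ Ψ : Literature.AlgebraicGeometry.HodgeTheory.complexBetti S'' (2 * 1) ≃ₗ[ℂ] Literature.AlgebraicGeometry.HodgeTheory.complexBetti S (2 * 1), (∀ y, Literature.AlgebraicGeometry.HodgeTheory.IsRationalClass y → Literature.AlgebraicGeometry.HodgeTheory.IsRationalClass (Ψ.symm y)) ∧ (∀ (i j : ℕ) y, Literature.AlgebraicGeometry.HodgeTheory.IsOfHodgeType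 2 S (2 * 1) i j y → Literature.AlgebraicGeometry.HodgeTheory.IsOfHodgeType 2 S'' (2 * 1) i j (Ψ.symm y)) ∧ ∃ γ ∈ Literature.AlgebraicGeometry.HodgeTheory.algebraicClasses (CategoryTheory.MonoidalCategoryStruct.tensorObj S S'') 2, ∀ x : Literature.AlgebraicGeometry.HodgeTheory.complexBetti S'' (2 * 1), Ψ x = Literature.AlgebraicGeometry.HodgeTheory.complexGysin μ (Literature.AlgebraicGeometry.Motives.IsSmoothProjective.tensor_holds hS.1 hS''.1) hS.1 (CategoryTheory.SemiCartesianMonoidalCategory.fst S S'') (rfl : 2 * 1 + 2 * 2 + 2 * 2 = 2 * 1 + 2 * (2 + 2)) (Literature.AlgebraicTopology.SingularHomology.cupProduct (rfl : 2 * 1 + 2 * 2 = 2 * 1 + 2 * 2) (Literature.AlgebraicGeometry.HodgeTheory.complexBetti.map (CategoryTheory.SemiCartesianMonoidalCategory.snd S S'') (2 * 1) x) γ)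


/-- A square root of `2` in `ℂ`. [folklore] -/
theorem exists_complex_sq_eq_two : ∃ c : ℂ, c * c = 2 :=
  ⟨(Real.sqrt 2 : ℂ), by
    rw [← Complex.ofReal_mul, Real.mul_self_sqrt (by norm_num : (0:ℝ) ≤ 2)]
    norm_num⟩

/-- T1′ (REAL CARRIERS — (R) IS THE WHOLE CONTENT).  WITHOUT the rationality clause the crux follows
from the diagonal class alone, ON THE TREE'S OWN CARRIERS: witness `S″ = S`, `p″ = p`,
`Ψ = c • id` with `c² = 2` — (T) because each `A.hodgePQ` is a `ℂ`-submodule and `IsOfHodgeType` is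
`∃ A`, (H) by bilinearity of `cupProduct`, (A) with `γ = c • Δ` because `algebraicClasses` is a
`ℂ`-submodule and `complexGysin`, `cupProduct` are `ℂ`-linear.  So every proof of the crux must use
(R) essentially: `IsRationalClass` is the only clause not closed under `c ∈ ℂˣ`. [folklore] -/
theorem withoutR_of_diagonalClass (hΔ : DiagonalClass) : TwinTwistorTransportWithoutR := by
  intro μ hμ S hS p hp
  obtain ⟨Δ, hΔmem, hΔact⟩ := hΔ μ hμ S hS
  obtain ⟨c, hc⟩ := exists_complex_sq_eq_two
  have hc0 : c ≠ 0 := by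
    rintro rfl
    norm_num at hc
  let Ψ : Literature.AlgebraicGeometry.HodgeTheory.complexBetti S (2 * 1) ≃ₗ[ℂ]
      Literature.AlgebraicGeometry.HodgeTheory.complexBetti S (2 * 1) :=
    LinearEquiv.smulOfNeZero ℂ _ c hc0
  have hΨ : ∀ x, Ψ x = c • x := fun x => rfl
  have hΨs : ∀ y, Ψ.symm y = c⁻¹ • y := fun y => by
    rw [LinearEquiv.symm_apply_eq, hΨ, smul_smul, mul_inv_cancel₀ hc0, one_smul]
  refine ⟨S, hS, p, hp, Ψ, ?_, ?_, ?_⟩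
  · intro i j y hy
    obtain ⟨A, hA⟩ := hy
    refine ⟨A, ?_⟩
    rw [hΨs, map_smul]
    exact Submodule.smul_mem _ _ hA
  · intro u v b huv
    rw [hΨs, hΨs, LinearMap.map_smul₂, map_smul, huv, smul_smul, smul_smul]
    congr 1
    rw [← mul_inv, hc, inv_mul_cancel_left₀ two_ne_zero]
  · refine ⟨c • Δ, Submodule.smul_mem _ _ hΔmem, fun x => ?_⟩
    rw [map_smul, map_smul, hΔact, hΨ]

/-- T2′ (REAL CARRIERS — (H) IS LOAD-BEARING TOO).  WITHOUT the halving clause the crux follows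
from the diagonal class alone: witness `S″ = S`, `p″ = p`, `Ψ = id` (`LinearEquiv.refl`), (R) and (T)
trivially, (A) with `γ = Δ`.  Together with T1′: modulo `[Δ]_* = id` the content of the typed crux
is exactly the CONJUNCTION (R) ∧ (H) — a RATIONAL algebraic correspondence which is ALSO a
2-similitude; either clause alone is met by a multiple of the diagonal. [folklore] -/
theorem withoutH_of_diagonalClass (hΔ : DiagonalClass) : TwinTwistorTransportWithoutH := by
  intro μ hμ S hS p hp
  obtain ⟨Δ, hΔmem, hΔact⟩ := hΔ μ hμ S hS
  refine ⟨S, hS, p, hp, LinearEquiv.refl ℂ _, ?_, ?_, ?_⟩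
  · intro y hy
    simpa using hy
  · intro i j y hy
    simpa using hy
  · exact ⟨Δ, hΔmem, fun x => (hΔact x).symm⟩

end RealCarriers

/-! ## T2 — the diagonal is not an instance: `Ψ = id` forces the cup form to vanish -/

/-- T2 (MULTIPLIER RIGIDITY).  If a bilinear form satisfies the crux's halving clause for `Ψ = id`,
`B u v = 2b ⟹ B u v = b`, then `B = 0`.  On a K3 surface the cup form is non-zero, so `S″ = S`,
`Ψ = id` (Buskin's identity, a Fourier–Mukai partner) is never a witness: the typed crux cannot be
"run at `ι = id`"; that cheapest falsifier of the route tests the mechanism, not this statement.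
[folklore] -/
theorem halving_id_forces_zero {K V : Type*} [Field K] [AddCommGroup V] [Module K V]
    (B : V →ₗ[K] V →ₗ[K] K) (h2 : (2 : K) ≠ 0)
    (h : ∀ (u v : V) (b : K), B u v = 2 * b → B u v = b) : B = 0 := by
  ext u v
  have hb : B u v = 2 * (B u v / 2) := by
    rw [mul_div_cancel₀ _ h2]
  have h' := h u v (B u v / 2) hb
  -- `x = x / 2` with `2 ≠ 0` forces `x = 0`
  have hx : 2 * (B u v) = B u v := by
    conv_rhs => rw [hb, ← h']
  have : B u v = 0 := by
    have h3 : (2 - 1) * B u v = 0 := by rw [sub_mul, one_mul, hx, sub_self]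
    norm_num at h3
    exact h3
  simpa using this

/-! ## T7 — (H) is exactly "Ψ is a 2-similitude" -/

/-- T7.  For a linear equivalence `Ψ` and `2 ≠ 0`, the crux's halving clause on `Ψ⁻¹`
(`B u v = 2b ⟹ B″ (Ψ⁻¹u) (Ψ⁻¹v) = b`) is equivalent to `Ψ` doubling the form
(`B (Ψx) (Ψy) = 2·B″ x y`), the hypothesis shape of `TwinSimilitudeAlgebraic` / of
`Theorems.twinSimilitudeAlgebraic_of_anchor`. [folklore] -/
theorem halving_iff_twoSimilitude {K V V'' : Type*} [Field K] [AddCommGroup V] [Module K V]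
    [AddCommGroup V''] [Module K V'']
    (Ψ : V'' ≃ₗ[K] V) (B : V →ₗ[K] V →ₗ[K] K)
    (B'' : V'' →ₗ[K] V'' →ₗ[K] K) (h2 : (2 : K) ≠ 0) :
    (∀ (u v : V) (b : K), B u v = 2 * b → B'' (Ψ.symm u) (Ψ.symm v) = b) ↔
      ∀ x y : V'', B (Ψ x) (Ψ y) = 2 * B'' x y := by
  constructor
  · intro h x y
    have := h (Ψ x) (Ψ y) (B (Ψ x) (Ψ y) / 2) (by rw [mul_div_cancel₀ _ h2])
    rw [Ψ.symm_apply_apply, Ψ.symm_apply_apply] at this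
    rw [this, mul_div_cancel₀ _ h2]
  · intro h u v b hb
    have := h (Ψ.symm u) (Ψ.symm v)
    rw [Ψ.apply_symm_apply, Ψ.apply_symm_apply, hb] at this
    exact (mul_right_injective₀ h2 this).symm

/-! ## T5/T6 — (T) and (R) for `Ψ⁻¹` follow from the same for `Ψ` and equal dimensions -/

/-- T5 ((T) FOR THE INVERSE IS BOOKKEEPING).  If a linear equivalence `Ψ` maps a subspace `W″` into
a finite-dimensional subspace `W` of the same dimension, then `Ψ⁻¹` maps `W` into `W″`.  With
`W″ = H^{i,j}(S″)`, `W = H^{i,j}(S)` (`h^{i,j} = 1, 20, 1`): an algebraic, hence Hodge, `Ψ` has a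
type-preserving inverse — clause (T) of the crux costs a prover nothing beyond (A), bijectivity and
the Hodge numbers of a K3. [folklore] -/
theorem symm_mem_of_map_le_of_finrank_eq {K V V'' : Type*} [Field K] [AddCommGroup V] [Module K V]
    [AddCommGroup V''] [Module K V'']
    (Ψ : V'' ≃ₗ[K] V) (W'' : Submodule K V'')
    (W : Submodule K V) [FiniteDimensional K W] (hmap : W''.map (Ψ : V'' →ₗ[K] V) ≤ W)
    (hdim : Module.finrank K W'' = Module.finrank K W) {y : V} (hy : y ∈ W) :
    Ψ.symm y ∈ W'' := by
  have heq : W''.map (Ψ : V'' →ₗ[K] V) = W :=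
    Submodule.eq_of_le_of_finrank_eq hmap (by rw [LinearEquiv.finrank_map_eq, hdim])
  rw [← heq] at hy
  obtain ⟨x, hx, rfl⟩ := hy
  simpa using hx

/-- T6 ((R) FOR THE INVERSE IS BOOKKEEPING), pointwise form of T5: if `Ψ` maps every element of
`W″` into `W`, `dim W″ = dim W < ∞`, then `Ψ⁻¹` maps `W` into `W″`.  Applied over `K = ℚ` to
`Ψ.restrictScalars ℚ` and the `ℚ`-forms `H²(S″,ℚ)`, `H²(S,ℚ)` (both of dimension `22`): a rational
bijective `Ψ` has a rational inverse. [folklore] -/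
theorem symm_mem_of_forall_mem {K V V'' : Type*} [Field K] [AddCommGroup V] [Module K V]
    [AddCommGroup V''] [Module K V'']
    (Ψ : V'' ≃ₗ[K] V) (W'' : Submodule K V'') (W : Submodule K V)
    [FiniteDimensional K W] (hmap : ∀ x ∈ W'', Ψ x ∈ W)
    (hdim : Module.finrank K W'' = Module.finrank K W) {y : V} (hy : y ∈ W) :
    Ψ.symm y ∈ W'' := by
  refine symm_mem_of_map_le_of_finrank_eq Ψ W'' W ?_ hdim hy
  rintro _ ⟨x, hx, rfl⟩
  exact hmap x hx

/-! ## T8/T9 — the outer `∀ μ` and the sign of `p` are harmless -/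

/-- T8 (`∀ μ` HARMLESS).  If `Ψ x = G x γ` for a map `G` linear in `γ` (here: `γ ↦ fst_*(snd^*x ∪ γ)`)
with `γ` in a subspace `A` (the algebraic classes, a `ℂ`-subspace), then for every unit `c` (the
ratio of two `ℂ`-orientation families on the connected manifolds `(S × S″)(ℂ)`, `S(ℂ)`, by which the
Gysin map rescales) `Ψ x = (c • G x) γ'` with `γ' = c⁻¹ • γ ∈ A`. [folklore] -/
theorem orientation_rescaling_absorbed {K V V'' : Type*} [Field K] [AddCommGroup V] [Module K V]
    [AddCommGroup V''] [Module K V'']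
    {H : Type*} [AddCommGroup H] [Module K H]
    (G : V'' → (H →ₗ[K] V)) (A : Submodule K H) {γ : H} (hγ : γ ∈ A) {c : K} (hc : c ≠ 0) :
    ∃ γ' ∈ A, ∀ x : V'', G x γ = (c • G x) γ' :=
  ⟨c⁻¹ • γ, A.smul_mem _ hγ, fun x => by simp [hc]⟩

/-- T9 (SIGN OF `p` HARMLESS).  The halving clause for the generator pair `(p, p″)` is equivalent to
the clause for `(−p, −p″)`: the `∀ p` over both integral generators `±[S]` is answered by choosing
`p″` with the matching sign. Shadow: cup values written as multiples of the generators. [folklore] -/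
theorem sign_of_generator_absorbed {K V V'' L : Type*} [Field K] [AddCommGroup L] [Module K L]
    (cup : V → V → L) (cup'' : V'' → V'' → L) (N : V → V'') (p p'' : L) :
    (∀ (u v : V) (b : K), cup u v = (2 * b) • p → cup'' (N u) (N v) = b • p'') ↔
      ∀ (u v : V) (b : K), cup u v = (2 * b) • (-p) → cup'' (N u) (N v) = b • (-p'') := by
  constructor
  · intro h u v b hb
    have := h u v (-b) (by rw [hb, smul_neg, ← neg_smul, mul_neg])
    rw [this, neg_smul, smul_neg]
  · intro h u v b hb
    have := h u v (-b) (by rw [hb, smul_neg, ← neg_smul, mul_neg, neg_neg])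
    rw [this, neg_smul, smul_neg, neg_neg]


/-! ## T3 — no multiplier-2 self-similitude in odd rank: `S″ = S` is false for odd `rk T(S)` -/

section Det

/-- DISCRIMINANT SHIFT.  If `M` is a 2-similitude from the form `G″` to the form `G` on `ℚⁿ`
(`Mᵀ G M = 2 G″`), then `det(M)² · det G = 2ⁿ · det G″`. [folklore] -/
theorem det_sq_mul_det_of_twoSimilitude {n : ℕ} (G G'' M : Matrix (Fin n) (Fin n) ℚ)
    (h : Mᵀ * G * M = (2 : ℚ) • G'') : M.det ^ 2 * G.det = 2 ^ n * G''.det := by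
  have hd := congrArg Matrix.det h
  rw [Matrix.det_mul, Matrix.det_mul, Matrix.det_transpose, Matrix.det_smul, Fintype.card_fin] at hd
  rw [← hd]
  ring

/-- An isometry `N` from `G″` to `G` (`Nᵀ G N = G″`) gives `det(N)² · det G = det G″`. [folklore] -/
theorem det_sq_mul_det_of_isometry {n : ℕ} (G G'' N : Matrix (Fin n) (Fin n) ℚ)
    (h : Nᵀ * G * N = G'') : N.det ^ 2 * G.det = G''.det := by
  have hd := congrArg Matrix.det h
  rw [Matrix.det_mul, Matrix.det_mul, Matrix.det_transpose] at hd
  rw [← hd]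
  ring

/-- `2` is not the square of a rational number. [folklore] -/
theorem not_exists_rat_sq_eq_two : ¬ ∃ q : ℚ, q * q = 2 := by
  rintro ⟨q, hq⟩
  have h : Real.sqrt 2 = |(q : ℝ)| := by
    rw [← Real.sqrt_mul_self_eq_abs, ← Rat.cast_mul, hq]
    norm_num
  exact irrational_sqrt_two.ne_rat |q| (by rw [h, Rat.cast_abs])

/-- `q² ≠ 2^(2k+1) · r²` for rationals `q` and `r ≠ 0` (an odd power of `2` is not a rational square).
[folklore] -/
theorem rat_sq_ne_odd_pow_two_mul_sq (q r : ℚ) (hr : r ≠ 0) (k : ℕ) :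
    q ^ 2 ≠ 2 ^ (2 * k + 1) * r ^ 2 := by
  intro h
  apply not_exists_rat_sq_eq_two
  refine ⟨q / (2 ^ k * r), ?_⟩
  have h2k : (2 : ℚ) ^ k * r ≠ 0 := mul_ne_zero (pow_ne_zero _ two_ne_zero) hr
  rw [div_mul_div_comm, ← sq, ← sq, h, div_eq_iff (pow_ne_zero 2 h2k)]
  ring

/-- NO ODD SELF-ANCHOR.  A nondegenerate quadratic `ℚ`-space of odd dimension admits no
self-similitude of multiplier `2` (`det M² = 2ⁿ` is impossible for odd `n`).  Consequence for the
crux: a rational Hodge similitude maps `T(S)` to `T(S″)`; if `S″ = S` and `rk T(S) = 22 − ρ(S)` is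
odd (e.g. `ρ(S) = 1`, the very general projective K3), restricting `Ψ` to `T(S)_ℚ` contradicts this
lemma.  So the natural strengthening "`S″` may be taken equal to `S`" is FALSE and the existential
`∃ S″` of the crux is load-bearing (prior seat rattack-14393: "S″ = S impossible for odd ρ").
[folklore] -/
theorem no_self_twoSimilitude_of_odd {n : ℕ} (hn : Odd n) (G M : Matrix (Fin n) (Fin n) ℚ)
    (hG : G.det ≠ 0) (h : Mᵀ * G * M = (2 : ℚ) • G) : False := by
  have h1 := det_sq_mul_det_of_twoSimilitude G G M h
  have h2 : M.det ^ 2 = 2 ^ n := mul_right_cancel₀ hG h1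
  obtain ⟨k, rfl⟩ := hn
  exact rat_sq_ne_odd_pow_two_mul_sq M.det 1 one_ne_zero k (by rw [h2]; ring)

/-- NO ISOMETRIC TWIN IN ODD RANK.  If nondegenerate forms `G`, `G″` of odd dimension are related
both by a 2-similitude `M` (`Mᵀ G M = 2G″`) and by an isometry `N` (`Nᵀ G N = G″`), contradiction:
`det(M)² = 2ⁿ det(N)²`.  Consequence for the crux: when `rk T(S)` is odd the twin `S″` is NEVER
rationally Hodge-isometric to `S` on `T` — not a Fourier–Mukai partner, not reachable by
Buskin's theorem (`HodgeIsometryAlgebraic`) alone; the anchor class the crux asks for is a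
genuinely new (similitude) algebraic class. [folklore] -/
theorem no_isometric_twin_of_odd {n : ℕ} (hn : Odd n) (G G'' M N : Matrix (Fin n) (Fin n) ℚ)
    (hG : G.det ≠ 0) (hG'' : G''.det ≠ 0) (hM : Mᵀ * G * M = (2 : ℚ) • G'')
    (hN : Nᵀ * G * N = G'') : False := by
  have h1 := det_sq_mul_det_of_twoSimilitude G G'' M hM
  have h2 := det_sq_mul_det_of_isometry G G'' N hN
  have hNd : N.det ≠ 0 := by
    intro h0
    apply hG''
    rw [← h2, h0]
    ring
  have h3 : M.det ^ 2 = 2 ^ n * N.det ^ 2 := by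
    apply mul_right_cancel₀ hG
    rw [h1, ← h2]
    ring
  obtain ⟨k, rfl⟩ := hn
  exact rat_sq_ne_odd_pow_two_mul_sq M.det N.det hNd k h3

/-- Non-vacuity in EVEN dimension (so oddness is the point): on `ℚ²` with the hyperbolic form `U`,
`M = diag(1, 2)` is a self-similitude of multiplier `2` (`U(2) ⊂ U`, the block used by TwinExists /
`eEightTwoSimilitude_proof`). [folklore] -/
theorem self_twoSimilitude_even_example :
    (!![1, 0; 0, 2] : Matrix (Fin 2) (Fin 2) ℚ)ᵀ * !![0, 1; 1, 0] * !![1, 0; 0, 2] =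
      (2 : ℚ) • !![0, 1; 1, 0] ∧ (!![0, 1; 1, 0] : Matrix (Fin 2) (Fin 2) ℚ).det ≠ 0 := by
  constructor
  · ext i j
    fin_cases i <;> fin_cases j <;>
      simp [Matrix.mul_apply, Fin.sum_univ_two, Matrix.transpose_apply, Matrix.smul_apply]
  · simp [Matrix.det_fin_two]

end Det

/-! ## T4 — `Ψ⁻¹` is never integral on a unimodular lattice -/

/-- T4 (NO INTEGRAL HALVING).  If an additive map `N` between lattices with integer-valued forms
halves the form, `2·B″(Nu, Nv) = B(u, v)`, then `B` takes only even values; on the unimodular K3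
lattice `Λ = U³ ⊕ E₈(−1)²` there are `e, f ∈ U` with `e.f = 1`.  So the strengthening of the crux
asking `Ψ⁻¹` to be INTEGRAL (not merely rational) is false; `Ψ⁻¹` is at best half-integral
(`2Ψ⁻¹ = Ψ^adj` integral when `Ψ` is), while `Ψ` itself can be integral (landed
`Theorems.eEightTwoSimilitude_proof`). [folklore] -/
theorem not_integral_halving {L L'' : Type*} [AddCommGroup L] [AddCommGroup L'']
    (B : L →+ L →+ ℤ) (B'' : L'' →+ L'' →+ ℤ) (N : L →+ L'')
    (h : ∀ u v : L, 2 * B'' (N u) (N v) = B u v) {e f : L} (hef : B e f = 1) : False := by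
  have := h e f
  omega

end Summit.HodgeConjecture.HodgeConjecture.Cruxes.TwinTwistorTransport.Disproof
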